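import Summits.MatrixMultiplication.OmegaCensus.ThreeSetLineFarkasTable
import HarnessLib

/-!
# Spectral dual certificates: a left-kernel vector from one frequency pair (`≈ 4×` smaller certificate tables)

ω-census `pub-omega`, family (b3), seat pub-omega-group gen 40.  Framing: lottery ticket; floor = certified bounds/negative
ranges.  VALUE: a kernel TOOL (front-end of `ThreeSetLineFarkasFast` / `…Table`) for the three-set cube cells over `A ↠ ℤ_p²`;
NOT progress on ω.

The line matrix `M = circ(A) + hank(C)` over `ℤ_q` is block-diagonalised by the discrete Fourier transform: frequencies `k` and
`−k` couple into a `2 × 2` block.  A modular dual vector (`zᵀM ≡ 0 (mod ℓ)`) therefore lives on ONE frequency pair: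
`z(t) = α·ξ^t + β·ξ^{−t}` with `ξ = ζ^k`, `ζ` a `q`-th root of unity — in `𝔽_ℓ` when `ℓ ≡ 1 (mod q)` (split) or in
`𝔽_{ℓ²} = 𝔽_ℓ[√D]` when `ℓ ≡ −1 (mod q)` (inert; then `β = ᾱ` and `z = Tr(α ξ^t)`).  Measured on the `(4,4,20)@961` certificates
(kit j328341): `98 %` of the moduli are primes `≡ ±1 (mod 31)`.  So a certificate is `(ℓ, D, ξ, α, β)` — seven residues — instead
of the `q` residues of `z`: `specVec` rebuilds `z` in the kernel (`O(q)` multiplications in `𝔽_ℓ[√D]` on pairs), `certsOfN2`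
decodes a record table with a 2-bit type tag (`0` = explicit `enc_ℓ z` as in `ThreeSetLineFarkasTable`, `1` = spectral), and
`chunkChkS` feeds the decoded `(ℓ, enc_ℓ z)` pairs to `chunkChkG`; **`chunkChkS_sound`** is `chunkChkG_sound` (decoding is
irrelevant to soundness).  Index slots: `offset + 2^ob·(length + 2^lb·mbits)` in `ob + lb + 8` bits; record = `m + 2^mbits·payload`,
payload = `tag + 4·body`.
-/

namespace Summit.MatrixMultiplication.OmegaCensus

namespace LineInv

/-- Multiplication in `𝔽_m[√D]` on pairs `(x₁ + x₂√D)`. [folklore] -/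
def fq2mul (m D : ℕ) (x y : ℕ × ℕ) : ℕ × ℕ :=
  ((x.1 * y.1 + D * (x.2 * y.2)) % m, (x.1 * y.2 + x.2 * y.1) % m)

/-- The powers `ξ^0, …, ξ^{n-1}` in `𝔽_m[√D]`. [folklore] -/
def fq2pows (m D : ℕ) (ξ : ℕ × ℕ) : ℕ → ℕ × ℕ → List (ℕ × ℕ)
  | 0, _ => []
  | n + 1, cur => cur :: fq2pows m D ξ n (fq2mul m D cur ξ)

/-- The spectral dual vector `z(t) = (α·ξ^t + β·ξ^{−t}).re (mod m)`, `t < q`. [folklore] -/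
def specVec (q m D : ℕ) (ξ α β : ℕ × ℕ) : List ℕ :=
  let P := fq2pows m D ξ q (1 % m, 0)
  let Pinv := (P.take 1) ++ (P.drop 1).reverse
  List.zipWith (fun x y => ((fq2mul m D α x).1 + (fq2mul m D β y).1) % m) P Pinv

/-- Packing of a list in base `m` (little-endian), as consumed by `unpackG`. [folklore] -/
def encBase (m : ℕ) : List ℕ → ℕ
  | [] => 0
  | a :: l => a % m + m * encBase m l

/-- Base-`m` digit `j` of `n`. [folklore] -/
def digBase (m n j : ℕ) : ℕ := n / m ^ j % m

/-- Decode the certificates of datum `i` from a typed record table: index slots of `ob + lb + 8` bits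
(`offset`, `length`, `mbits`); record `r`: `m = r mod 2^mbits`, `payload = r >>> mbits`, `tag = payload mod 4`, `body = payload >>> 2`;
tag `0`: body = `enc_m z`; tag `1`: body = base-`m` digits `D, ξ₁, ξ₂, α₁, α₂, β₁, β₂` of a spectral certificate. [folklore] -/
def certsOfN2 (q slots ob lb I N i : ℕ) : List (ℕ × ℕ) :=
  (List.range slots).filterMap fun j =>
    let w := ob + lb + 8
    let e := bitsN I (w * (slots * i + j)) w
    let o := e % 2 ^ ob
    let len := (e >>> ob) % 2 ^ lb
    let mb := e >>> (ob + lb)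
    if len = 0 then none else
      let r := bitsN N o len
      let m := r % 2 ^ mb
      let payload := r >>> mb
      let body := payload >>> 2
      if payload % 4 = 0 then some (m, body)
      else
        let dg := digBase m body
        some (m, encBase m (specVec q m (dg 0) (dg 1, dg 2) (dg 3, dg 4) (dg 5, dg 6)))

/-- A window of `X`-data against a typed (explicit / spectral) certificate table. [folklore] -/
def chunkChkS (q K X : ℕ) (W : List ℕ) (Fs : List (List ℕ)) (slots ob lb I N : ℕ) : Bool :=
  chunkChkG q K X W Fs ((List.range Fs.length).map (certsOfN2 q slots ob lb I N))

section Sound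

variable {q : ℕ} [NeZero q]

/-- **Soundness of a window certified by a typed table** (semantic shape of `hkill`, `ThreeSetZpCells4Core`). [folklore] -/
theorem chunkChkS_sound {K X e slots ob lb I N : ℕ} {W : List ℕ} {Fs : List (List ℕ)}
    (h : chunkChkS q K X W Fs slots ob lb I N = true) :
    ∀ F ∈ Fs, ∀ (G : ZMod q → ℕ) (s : ZMod q), (∀ u, G u ≤ e) →
      ¬ ∀ τ : ZMod q, (∑ u : ZMod q, lineMat3 (vecFn W) (vecFn F) τ u * G u) + (if s = τ then 1 else 0) = K :=
  chunkChkG_sound h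

end Sound

end LineInv

end Summit.MatrixMultiplication.OmegaCensus
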